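import Summits.CriticalPhenomena.CardyFormulaZ2.Theorems.CardyBoundaryCoulombGasBoundaryDefectGaussianRStubTransportPathsPart8

/-!
# Stub `stub_transportPaths` of line `rainbow-monomials-in-excursion-kernels` — Part 11:
# metric facts about the edges of the polygon (periodicity, segments, adjacent and non-adjacent
# edges) (crux `CardyBoundaryCoulombGas.BoundaryDefectGaussianR`, stmt-CriticalPhenomena-14132)

With the polygon data of Part 8 taken as hypotheses (`c : ℤ → ℝ` strictly increasing with
`c (z + M) = c z + 1`, edges `γ t = γ (c z) + ‖γ t - γ (c z)‖ i^(a z)` on `[c z, c (z+1)]`,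
turning rule `a z + τ z ≡ a (z-1) + 2 (mod 4)` with `τ z` odd):

* `tp_c_shift` — `c (z + n M) = c z + n`; `tp_a_periodic` — `a (z + M) = a z`;
* `tp_param_cover` — every parameter is, up to an integer, in one of the `M` edge intervals
  following any given index;
* `tp_perp_sq` — Pythagoras for perpendicular axis directions; `tp_adjacent_dist` — a point of an
  edge is at least as far from any point of an ADJACENT edge as from their common corner;
* `tp_nonadjacent_dist` — points of NON-ADJACENT edges (`z + 2 ≤ z' ≤ z + M - 2`) are uniformly
  `≥ κ₀ > 0` apart (tube lemma of Part 4 at the minimal edge parameter length).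
These feed the uniform flat charts along the edges (Part 12). All [folklore].
-/

noncomputable section

open Set Filter Metric Topology
open Literature.Probability.RandomPlanarGeometry
open Summit.CriticalPhenomena.CardyFormulaZ2.Cruxes.RectilinearCardy.ExcursionKernelCovariance

namespace Summit.CriticalPhenomena.CardyFormulaZ2.Cruxes.BoundaryDefectGaussianR.RainbowMonomialsInExcursionKernels

/-! ### Periodicity -/

/-- `c (z + n M) = c z + n`. [folklore] -/
theorem tp_c_shift {M : ℕ} {c : ℤ → ℝ} (hcper : ∀ z, c (z + M) = c z + 1) :
    ∀ (z n : ℤ), c (z + n * M) = c z + n := by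
  intro z n
  induction n using Int.induction_on generalizing z with
  | zero => simp
  | succ n ih =>
    have e : z + (↑n + 1) * ↑M = (z + ↑n * ↑M) + ↑M := by ring
    rw [e, hcper, ih]; push_cast; ring
  | pred n ih =>
    have h := hcper (z + (-↑n - 1) * ↑M)
    have e2 : z + (-↑n - 1) * ↑M + ↑M = z + -↑n * ↑M := by ring
    rw [e2, ih] at h
    push_cast at h ⊢
    linarith

/-- **The edge directions are periodic**: `a (z + M) = a z` (the edge `z + M` is the edge `z`
re-parametrised one period later; uniqueness of the outgoing direction). [folklore] -/
theorem tp_a_periodic (D : JordanDomain) {M : ℕ} {c : ℤ → ℝ} {a : ℤ → ℕ}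
    (hcmono : StrictMono c) (hcper : ∀ z, c (z + M) = c z + 1) (ha4 : ∀ z, a z < 4)
    (hdir : ∀ z, ∀ t ∈ Icc (c z) (c (z + 1)), D.boundary t =
      D.boundary (c z) + ((‖D.boundary t - D.boundary (c z)‖ : ℝ) : ℂ) * Complex.I ^ (a z))
    (hmono : ∀ z, StrictMonoOn (fun t => ‖D.boundary t - D.boundary (c z)‖) (Icc (c z) (c (z + 1)))) :
    ∀ z, a (z + M) = a z := by
  intro z
  have hper : ∀ t : ℝ, D.boundary (t + 1) = D.boundary t := fun t => D.periodic_boundary t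
  have hη : 0 < c (z + 1) - c z := sub_pos.2 (hcmono (by omega))
  have hc1 : c (z + M) = c z + 1 := hcper z
  have hc2 : c (z + M + 1) = c (z + 1) + 1 := by
    rw [show z + M + 1 = z + 1 + M by ring]; exact hcper (z + 1)
  refine tp_out_unique (γ := D.boundary) (t := c z) hη hη (ha4 (z + M)) (ha4 z) ?_ ?_ ?_
  · intro t ht
    rw [add_sub_cancel] at ht
    have ht1 : t + 1 ∈ Icc (c (z + M)) (c (z + M + 1)) := by
      rw [hc1, hc2]; exact ⟨by linarith [ht.1], by linarith [ht.2]⟩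
    have h := hdir (z + M) (t + 1) ht1
    rw [hc1, hper, hper] at h
    exact h
  · rw [add_sub_cancel]; exact hmono z
  · intro t ht
    rw [add_sub_cancel] at ht
    exact hdir z t ht

/-! ### Covering the parameter line by one period of edges -/

/-- **One period of edges covers the loop.** For every `s : ℝ` and every index `z₀`, some
integer translate of `s` lies in one of the edge intervals `[c z, c (z+1))`, `z₀ ≤ z < z₀ + M`.
[folklore] -/
theorem tp_param_cover {M : ℕ} {c : ℤ → ℝ} (hM : 0 < M)
    (hcper : ∀ z, c (z + M) = c z + 1) (s : ℝ) (z₀ : ℤ) :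
    ∃ z : ℤ, z₀ ≤ z ∧ z < z₀ + M ∧ ∃ n : ℤ, s + n ∈ Ico (c z) (c (z + 1)) := by
  classical
  set n : ℤ := ⌈c z₀ - s⌉ with hn
  set s' := s + n with hs'
  have hs'1 : c z₀ ≤ s' := by have := Int.le_ceil (c z₀ - s); rw [hs']; linarith
  have hs'2 : s' < c z₀ + 1 := by have := Int.ceil_lt_add_one (c z₀ - s); rw [hs']; linarith
  have hex : ∃ m : ℕ, m < M ∧ s' < c (z₀ + m + 1) := by
    refine ⟨M - 1, by omega, ?_⟩
    have e : z₀ + ((M - 1 : ℕ) : ℤ) + 1 = z₀ + M := by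
      rw [Nat.cast_sub (by omega)]; push_cast; ring
    rw [e, hcper]
    exact hs'2
  set m := Nat.find hex with hm
  obtain ⟨hmM, hms⟩ := Nat.find_spec hex
  refine ⟨z₀ + m, by omega, by omega, n, ?_, ?_⟩
  · -- `c (z₀ + m) ≤ s'` by minimality of `m`
    by_cases hm0 : (m : ℕ) = 0
    · have : (Nat.find hex : ℤ) = 0 := by exact_mod_cast hm0
      rw [this, add_zero]; exact hs'1
    · have hmin := Nat.find_min hex (m := Nat.find hex - 1) (by omega)
      push Not at hmin
      have h := hmin (by omega)
      have e : z₀ + ((Nat.find hex - 1 : ℕ) : ℤ) + 1 = z₀ + (Nat.find hex : ℕ) := by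
        rw [Nat.cast_sub (by omega)]; push_cast; ring
      rw [e] at h
      exact h
  · exact hms

/-! ### Adjacent edges: Pythagoras -/

/-- **Pythagoras for perpendicular axis directions**: `‖s' i^e' + s i^e‖² = s'² + s²` when
`e + e'` is odd. [folklore] -/
theorem tp_perp_sq {e e' : ℕ} (he : e < 4) (he' : e' < 4) (hodd : (e + e') % 2 = 1) (s s' : ℝ) :
    ‖(s' : ℂ) * Complex.I ^ e' + (s : ℂ) * Complex.I ^ e‖ ^ 2 = s' ^ 2 + s ^ 2 := by
  rw [Complex.sq_norm, Complex.normSq_apply]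
  interval_cases e <;> interval_cases e' <;> simp_all [pow_succ] <;> ring

/-- **Adjacent edges.** If `q = P + s i^e` and `w = P + s' i^e'` with `i^e ⊥ i^e'`
(`e + e'` odd), then `|s| ≤ dist q w`: a point of an edge is at least as far from any point of the
adjacent edge as from the common corner `P`. [folklore] -/
theorem tp_adjacent_dist {e e' : ℕ} (he : e < 4) (he' : e' < 4) (hodd : (e + e') % 2 = 1)
    (P : ℂ) (s s' : ℝ) :
    |s| ≤ dist (P + (s' : ℂ) * Complex.I ^ e') (P + (s : ℂ) * Complex.I ^ e) := by
  have h := tp_perp_sq he he' hodd (-s) s'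
  rw [dist_eq_norm, show P + (s' : ℂ) * Complex.I ^ e' - (P + (s : ℂ) * Complex.I ^ e) =
    (s' : ℂ) * Complex.I ^ e' + ((-s : ℝ) : ℂ) * Complex.I ^ e by push_cast; ring]
  have h2 : |s| ^ 2 ≤ ‖(s' : ℂ) * Complex.I ^ e' + ((-s : ℝ) : ℂ) * Complex.I ^ e‖ ^ 2 := by
    rw [h, sq_abs]; nlinarith
  exact (pow_le_pow_iff_left₀ (abs_nonneg s) (norm_nonneg _) two_ne_zero).1 h2

/-- The turning rule makes consecutive edges perpendicular: `a z + a (z-1)` is odd. [folklore] -/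
theorem tp_consecutive_odd {a τ : ℤ → ℕ} (hτ : ∀ z, τ z = 1 ∨ τ z = 3)
    (hmodτ : ∀ z, (a z + τ z) % 4 = (a (z - 1) + 2) % 4) (z : ℤ) :
    (a z + a (z - 1)) % 2 = 1 := by
  have h := hmodτ z
  rcases hτ z with h1 | h1 <;> rw [h1] at h <;> omega

/-! ### Non-adjacent edges: a uniform positive distance -/

/-- **Non-adjacent edges are uniformly apart.** For the boundary loop of a Jordan domain with
corner parameters `c` (`M ≥ 2` per period), there is `κ₀ > 0` such that points of the edges `z`
and `z'` with `z + 2 ≤ z' ≤ z + M - 2` are at distance `≥ κ₀` (their parameters are at cyclic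
distance at least the minimal edge parameter length; tube lemma). [folklore] -/
theorem tp_nonadjacent_dist (D : JordanDomain) {M : ℕ} {c : ℤ → ℝ} (hM2 : 2 ≤ M)
    (hcmono : StrictMono c) (hcper : ∀ z, c (z + M) = c z + 1) :
    ∃ κ₀ : ℝ, 0 < κ₀ ∧ ∀ z z' : ℤ, z + 2 ≤ z' → z' ≤ z + M - 2 →
      ∀ t ∈ Icc (c z) (c (z + 1)), ∀ t' ∈ Icc (c z') (c (z' + 1)),
        κ₀ ≤ dist (D.boundary t) (D.boundary t') := by
  classical
  -- the minimal edge parameter length over one period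
  have hne : (Finset.range M).Nonempty := ⟨0, Finset.mem_range.2 (by omega)⟩
  obtain ⟨m₀, hm₀, hmin⟩ := (Finset.range M).exists_min_image (fun m : ℕ => c (m + 1) - c m) hne
  set η₁ := c ((m₀ : ℤ) + 1) - c m₀ with hη₁
  have hη₁0 : 0 < η₁ := sub_pos.2 (hcmono (by omega))
  have hshift := tp_c_shift hcper
  have hM0 : (0 : ℤ) < M := by exact_mod_cast (show 0 < M by omega)
  have hηle : ∀ z : ℤ, η₁ ≤ c (z + 1) - c z := by
    intro z
    set q := z / M with hq
    set r := z % M with hr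
    have hr0 : 0 ≤ r := Int.emod_nonneg z hM0.ne'
    have hrM : r < M := Int.emod_lt_of_pos z hM0
    have hz : z = r + q * M := by
      have := Int.emod_add_mul_ediv z M
      rw [← hr, ← hq] at this
      linarith
    have e1 : c z = c r + q := by rw [hz]; exact hshift r q
    have e2 : c (z + 1) = c (r + 1) + q := by
      rw [hz, show r + q * ↑M + 1 = (r + 1) + q * ↑M by ring]; exact hshift (r + 1) q
    have hrn : ((r.toNat : ℕ) : ℤ) = r := Int.toNat_of_nonneg hr0
    have hmem : r.toNat ∈ Finset.range M := Finset.mem_range.2 (by omega)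
    have h := hmin r.toNat hmem
    rw [hrn] at h
    rw [e1, e2]
    linarith
  have hη₁2 : η₁ ≤ 1 / 2 := by
    have h0 := hηle 0
    have h1 := hηle 1
    have h2 : c 2 ≤ c M := hcmono.monotone (by omega)
    have h3 : c (0 + M) = c 0 + 1 := hcper 0
    simp only [zero_add] at h0 h3
    norm_num at h1
    linarith
  obtain ⟨κ₀, hκ₀, htube⟩ := tp_tube D hη₁0 hη₁2
  refine ⟨κ₀, hκ₀, fun z z' h1 h2 t ht t' ht' => htube t t' fun n => ?_⟩
  -- the translate `t - n` lies on the edge `z - n M`, never adjacent to `z'`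
  have es : c (z - n * M) = c z - n := by
    have := hshift z (-n); rw [show z + -n * ↑M = z - n * ↑M by ring] at this
    rw [this]; push_cast; ring
  have es1 : c (z - n * M + 1) = c (z + 1) - n := by
    have := hshift (z + 1) (-n); rw [show z + 1 + -n * ↑M = z - n * ↑M + 1 by ring] at this
    rw [this]; push_cast; ring
  rcases lt_trichotomy n 0 with hn | hn | hn
  · -- `n ≤ -1`: the translate is at least two edges after `z'`
    have hnM : n * M ≤ -M := by nlinarith
    have hle : c (z' + 2) ≤ c (z - n * M) := hcmono.monotone (by omega)
    have hgap := hηle (z' + 1)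
    rw [show z' + 1 + 1 = z' + 2 by ring] at hgap
    rw [abs_of_nonneg (by linarith [ht.1, ht'.2])]
    linarith [ht.1, ht'.2]
  · subst hn
    have hle : c (z + 1) ≤ c (z' - 1) := hcmono.monotone (by omega)
    have hgap := hηle (z' - 1)
    rw [sub_add_cancel] at hgap
    simp only [Int.cast_zero, sub_zero]
    rw [abs_of_nonpos (by linarith [ht.2, ht'.1])]
    linarith [ht.2, ht'.1]
  · -- `n ≥ 1`: the translate is at least two edges before `z'`
    have hnM : (M : ℤ) ≤ n * M := by nlinarith
    have hle : c (z - n * M + 1) ≤ c (z' - 1) := hcmono.monotone (by omega)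
    have hgap := hηle (z' - 1)
    rw [sub_add_cancel] at hgap
    rw [abs_of_nonpos (by linarith [ht.2, ht'.1])]
    linarith [ht.2, ht'.1]

/-- **Registered sub-goal `s7_nonadjacentDist` of stub `stub_transportPaths`** (non-adjacent edges
are uniformly apart, one-line form of `tp_nonadjacent_dist`). [folklore] -/
theorem s7_nonadjacentDist : ∀ (D : Literature.Probability.RandomPlanarGeometry.JordanDomain) (M : ℕ) (c : ℤ → ℝ), 2 ≤ M → StrictMono c → (∀ z, c (z + M) = c z + 1) → ∃ κ₀ : ℝ, 0 < κ₀ ∧ ∀ z z' : ℤ, z + 2 ≤ z' → z' ≤ z + M - 2 → ∀ t ∈ Set.Icc (c z) (c (z + 1)), ∀ t' ∈ Set.Icc (c z') (c (z' + 1)), κ₀ ≤ dist (D.boundary t) (D.boundary t') :=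
  fun D _ _ hM2 hcmono hcper => tp_nonadjacent_dist D hM2 hcmono hcper

end Summit.CriticalPhenomena.CardyFormulaZ2.Cruxes.BoundaryDefectGaussianR.RainbowMonomialsInExcursionKernels

end
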